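import Literature.IUT.LogThetaLattice.HolomorphicLogShellsProofs
import Literature.IUT.LogVolume.UnitLogVolume
import Literature.AnabelianGeometry.AbsoluteAnabelian.LogShellVolumes
import HarnessLib

/-!
# [IUTchIII] Proposition 1.2 (vi), unconditional numerical form: `μ_K^log(ℐ_K) = (f·e·c − f − m)·log p`

Mochizuki, *Inter-universal Teichmüller Theory III*, kurims manuscript (May 2020), §1, Prop 1.2 (vi) p.32
(claim key `Mochizuki2012`, D-0012, status disputed); [AbsTopIII] Prop 5.8 (iii) p.140 (the mono-analytic
normalisation `μ^log(ℐ(G)) = {-1 - m/f + e·log(p*)/log p}·f·log p`) and Cor 5.10 (i), (iv)(d) pp.147–148;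
[IUTchIV] Prop 1.4 (ii) p.13 (`μ^log(log_p(R^×)) = -(1/e + m/(ef))·log p`, un-normalised `-(f + m)·log p`).

Sequel PROOF-ONLY companion (no definitions) of `HolomorphicLogShellsProofs.lean` (abc-iut-L6-d2), at the
standard model `L = PadicLogOnUnits.ofUnitLog p K` of abc-iut-S1's real `p`-adic logarithm:

* `localLogVolume_logUnits_eq` — `μ_K^log(log_p(𝒪_K^×)) = −(f + m)·log p` read in abc-iut-L4-t3's
  (real-valued) vocabulary: a one-line bridge of abc-iut-S8's `Literature.IUT.LogVolume.localLogVolume_logUnits_eq`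
  (`UnitLogVolume.lean`, [IUTchIV] Prop 1.4 (ii): Haar count `μ_K(log_p(R^×))·#R^μ = 1 − p^{−f}` with
  abc-iut-S1's `#R^μ = p^m·(p^f − 1)`, `m = torsionPExp p K`, `f = residueDegree p K`) — consumed by name,
  nothing re-proved;
* **IUTchIII:Prop1.2(vi)** `holMonoVolumeCompatible_ofUnitLog` — abc-iut-L6-t3's predicate
  `HolMonoVolumeCompatible (ofUnitLog p K) t` HOLDS for the numerical type `t = (p, f, e, m)` OF `K`
  (`t.f = residueDegree p K`, `t.e = absRamificationIdx p K`, `t.m = torsionPExp p K`): the holomorphic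
  log-shell has exactly the mono-analytic log-volume `t.logShellLogVolume` of [AbsTopIII] Prop 5.8 (iii);
* the nonarchimedean rows of abc-iut-L4-t3's `LogShellVolumes.lean` at the standard model (abc-iut-L4-lead
  RULING 2026-08-25T20:03:04Z: "L6-d2 keeps the non-archimedean (i)/(iv)(d) rows"): [AbsTopIII] Cor 5.10 (i)
  `logShellFiniteVolume_ofUnitLog` (HOLDS), and Cor 5.10 (iv)(d) `monoAnalyticLogShellVolume_ofUnitLog_iff` —
  the named fact `MonoAnalyticLogShellVolume (ofUnitLog p K) t` pins `p`, `f`, `e` of `K` in its hypotheses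
  but not `m`, so at the standard model it holds IF AND ONLY IF `t.m = torsionPExp p K` (for `t.m = m_K` it
  is `holMonoVolumeCompatible_ofUnitLog`; for `t.m ≠ m_K` its hypotheses are met by any norm uniformizer and
  its conclusion is off by `(m_K − t.m)·log p ≠ 0`) — recorded so that the statement file can add the
  printed definition of `m` ("`p^m` = the order of the group of `p`-power roots of unity of `k`",
  [AbsTopIII] Prop 5.8 (i)) as a hypothesis; finding INBOXed to abc-iut-L4-t3 / abc-iut-L4-lead
  2026-08-25T19:58:25Z.

Classical local-field facts; the locators record which printed clauses are kernel-checked. Nothing here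
bears on the disputed [IUTchIII] Cor 3.12 or takes a side.
-/

noncomputable section

namespace Literature.IUT.LogThetaLattice

open Set Metric MeasureTheory
open scoped Pointwise NNReal ENNReal
open Literature.AnabelianGeometry.AbsoluteAnabelian
open Literature.IUT.LogVolume (unitLog absRamificationIdx residueDegree torsionPExp norm_prime_eq_norm_pow
  card_residueField)
open Literature.NumberTheory.GaloisRepresentations.Ultrametric

variable (p : ℕ) [Fact p.Prime]
variable (K : Type*) [NontriviallyNormedField K] [instK : NormedAlgebra ℚ_[p] K] [IsUltrametricDist K]
  [ProperSpace K]

/-! ### [IUTchIV] Prop 1.4 (ii), un-normalised, in abc-iut-L4-t3's vocabulary -/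

variable [MeasurableSpace K] [BorelSpace K]

/-- **[IUTchIV] Prop 1.4 (ii), un-normalised**, read on abc-iut-L4-t3's real-valued log-volume:
`μ_K^log(log_p(𝒪_K^×)) = −(f + m)·log p`, `f = residueDegree p K`, `m = torsionPExp p K` — abc-iut-S8's
`Literature.IUT.LogVolume.localLogVolume_logUnits_eq` transported along the bridge `localVolume_eq_toReal`.
[claim: Mochizuki2012, status: disputed] -/
theorem localLogVolume_logUnits_eq :
    localLogVolume K (LogVolume.logUnits K) = -((residueDegree p K + torsionPExp p K : ℕ) * Real.log p) := by
  rw [localLogVolume, localVolume_eq_toReal, ← LogVolume.localLogVolume_eq_log,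
    LogVolume.localLogVolume_logUnits_eq p K]
  push_cast
  ring

/-! ### [IUTchIII] Prop 1.2 (vi) and [AbsTopIII] Prop 5.8 (iii): the log-volume of the holomorphic log-shell -/

/-- **IUTchIII:Prop1.2(vi)** (kurims p.32) `μ_K^log(ℐ_K) = (f·e·c − f − m)·log p` for the log-shell of the real
logarithm (`c = 2` if `p = 2`, else `1`; `f`, `e`, `m` = residue degree, absolute ramification index,
`p`-power torsion exponent of `K`) — i.e. `μ_K(ℐ_K) = (p*)^{[K:ℚ_p]}·p^{−f}·p^{−m}`, the value behind
[AbsTopIII] Prop 5.8 (iii). [claim: Mochizuki2012, status: disputed] -/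
theorem localLogVolume_logShell_ofUnitLog_eq :
    localLogVolume K (logShell (PadicLogOnUnits.ofUnitLog p K)) =
      ((residueDegree p K * (absRamificationIdx p K * (if p = 2 then 2 else 1)) : ℕ) -
        (residueDegree p K + torsionPExp p K : ℕ)) * Real.log p := by
  rw [localLogVolume_logShell_ofUnitLog p K, localLogVolume_logUnits_eq p K]
  ring

/-- **IUTchIII:Prop1.2(vi)** (kurims p.32) "the various isomorphisms `log(†D^⊢_v) ⥲ log(†F^{⊢×μ}_v) ⥲ log(†F_v)`
… are compatible with … the respective log-shells, and the respective log-volumes" — UNCONDITIONAL numerical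
form: for the numerical type `t = (p, f, e, m)` of `K` ([AbsTopIII] Prop 5.8 (i): `f = residueDegree p K`,
`e = absRamificationIdx p K`, `p^m = #(p`-power roots of unity`)`, i.e. `m = torsionPExp p K`), abc-iut-L6-t3's
predicate `HolMonoVolumeCompatible (ofUnitLog p K) t` HOLDS: the holomorphic log-shell `ℐ_K` of the real
logarithm has log-volume `{-1 - m/f + e·log(p*)/log p}·f·log p = t.logShellLogVolume`, abc-iut-L4-t3's
mono-analytic value of [AbsTopIII] Prop 5.8 (iii). [claim: Mochizuki2012, status: disputed] -/
theorem holMonoVolumeCompatible_ofUnitLog (t : MLFType) (hp : t.p = p) (hf : t.f = residueDegree p K)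
    (he : t.e = absRamificationIdx p K) (hm : t.m = torsionPExp p K) :
    HolMonoVolumeCompatible (PadicLogOnUnits.ofUnitLog p K) t := by
  refine holMonoVolumeCompatible_ofUnitLog_of_logUnits p K t hp hf he ?_
  rw [hf, hm]
  exact localLogVolume_logUnits_eq p K

/-! ### The nonarchimedean rows of `LogShellVolumes.lean` ([AbsTopIII] Cor 5.10 (i), (iv)(d)) at the standard model -/

omit [MeasurableSpace K] [BorelSpace K] in
/-- **[AbsTopIII] Cor 5.10 (i), nonarchimedean** — abc-iut-L4-t3's named fact `LogShellFiniteVolume` HOLDS at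
the standard model: the log-shell `ℐ_K = (p*)⁻¹·log_p(𝒪_K^×)` of the real logarithm "is of finite log-volume"
(`ℐ_K ∈ M(K)`, `logShell_ofUnitLog_mem_compactOpens`). [cite: MochizukiAbsTopIII2015, Cor 5.10 (i) p. 147] -/
theorem logShellFiniteVolume_ofUnitLog : LogShellFiniteVolume (PadicLogOnUnits.ofUnitLog p K) :=
  logShell_ofUnitLog_mem_compactOpens p K

/-- The hypotheses of abc-iut-L4-t3's `MonoAnalyticLogShellVolume (ofUnitLog p K) t` are MET by every norm
uniformizer when `t.p = p`, `t.f = f_K`, `t.e = e_K`: `‖ϖ‖ < 1`, maximality of `‖ϖ‖` below `1`,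
`[𝒪 : ϖ𝒪] = p^f`, `‖p*‖ = ‖ϖ‖^{e·c}`, and `ℐ_K ∈ M(K)`; so the named fact yields its conclusion outright.
[cite: MochizukiAbsTopIII2015, Cor 5.10 (iv)(d) p. 148] -/
theorem localLogVolume_logShell_eq_of_monoAnalyticLogShellVolume (t : MLFType) (hp : t.p = p)
    (hf : t.f = residueDegree p K) (he : t.e = absRamificationIdx p K)
    (h : MonoAnalyticLogShellVolume (PadicLogOnUnits.ofUnitLog p K) t) :
    localLogVolume K (logShell (PadicLogOnUnits.ofUnitLog p K)) = t.logShellLogVolume := by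
  obtain ⟨ϖ, hϖ⟩ := exists_isUniformizer (F := K)
  refine h ϖ hϖ.norm_lt_one (fun x hx => hϖ.norm_le_of_norm_lt_one x hx) ?_ ?_
    (logShellFiniteVolume_ofUnitLog p K)
  · rw [hϖ.resIndex_eq_card_residueField, card_residueField p K, hp, hf]
  · rw [norm_pstar_ofUnitLog p K hϖ, hp, he]

/-- **[AbsTopIII] Cor 5.10 (iv)(d), nonarchimedean comparison, at the standard model**: abc-iut-L4-t3's named
fact `MonoAnalyticLogShellVolume (ofUnitLog p K) t` — "the field-theoretic log-volume of the log-shell equals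
the mono-analytically reconstructed value of Prop 5.8 (iii)" — holds for a numerical type `t` with `t.p = p`,
`t.f = f_K`, `t.e = e_K` IF AND ONLY IF `t.m` is the `p`-power torsion exponent of `K` (`torsionPExp p K`):
the predicate's hypotheses pin `p`, `f`, `e` but not `m`, while both sides of its conclusion are
`(f·e·c − f − m)·log p` with `m = m_K`, resp. `m = t.m` (`Real.log p ≠ 0`). For the genuine type of `K` this
DISCHARGES the row; for other `t` it records that the printed definition of `m` must enter as a hypothesis.
[cite: MochizukiAbsTopIII2015, Cor 5.10 (iv)(d) p. 148] -/
theorem monoAnalyticLogShellVolume_ofUnitLog_iff (t : MLFType) (hp : t.p = p)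
    (hf : t.f = residueDegree p K) (he : t.e = absRamificationIdx p K) :
    MonoAnalyticLogShellVolume (PadicLogOnUnits.ofUnitLog p K) t ↔ t.m = torsionPExp p K := by
  constructor
  · intro h
    have h1 := localLogVolume_logShell_eq_of_monoAnalyticLogShellVolume p K t hp hf he h
    rw [localLogVolume_logShell_ofUnitLog_eq p K, MLFType.logShellLogVolume_eq', hp, ← hf, ← he] at h1
    have hlog : Real.log p ≠ 0 := by
      have h1p : (1 : ℝ) < p := by exact_mod_cast (Fact.out : p.Prime).one_lt
      exact (Real.log_pos h1p).ne'
    have h2 := mul_right_cancel₀ hlog h1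
    have hc : ((t.f * (t.e * (if p = 2 then 2 else 1)) : ℕ) : ℝ) =
        (if p = 2 then 2 else 1) * (t.e : ℝ) * (t.f : ℝ) := by
      push_cast
      split_ifs <;> ring
    rw [hc, Nat.cast_add] at h2
    have h3 : ((torsionPExp p K : ℕ) : ℝ) = (t.m : ℝ) := by linarith
    exact_mod_cast h3.symm
  · intro hm _ _ _ _ _ _
    exact holMonoVolumeCompatible_ofUnitLog p K t hp hf he hm

end Literature.IUT.LogThetaLattice

end
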